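import Mathlib
import HarnessLib
import Literature.NumberTheory.GaloisRepresentations.GaloisRep
import Literature.NumberTheory.Automorphic.Paramodular.ParamodularForms

/-!
# The Galois representation attached to a weight-2 paramodular eigenform of prime level
# (Taylor, Laumon, Weissauer, Schmidt, Mok — as stated by Brumer et al.)

A NAMED FACT (`def … : Prop`, cited, not proved) recording the automorphic input of the
Faltings–Serre paramodularity proofs of [BrumerEtAl2019]: the existence of the `ℓ`-adic Galois
representation `ρ_{f,ℓ}` of a Siegel paramodular newform `f` of type **(G)**, with
`det(1 - ρ_{f,ℓ}(Frob_p) T) = Q_p(f,T)` at the good primes.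

## What is printed ([BrumerEtAl2019], Algebra & Number Theory 13:5 (2019), §4.3, pp. 1168–1172)

**Theorem 4.3.4** (Taylor, Laumon, Weissauer, Schmidt, and Mok). Let `f ∈ S_k(K(N))` be a Siegel
paramodular newform of weight `k ≥ 2` and level `N`. Suppose that `f` is of type (G). Then for any
prime `ℓ ∤ N`, there exists a continuous, semisimple Galois representation
`ρ_{f,ℓ} : Gal_ℚ → GSp₄(ℚ_ℓ^al)` with the following properties: (i) `det(ρ_{f,ℓ}) = χ_ℓ^{4k-6}`;
(ii) the similitude character of `ρ_{f,ℓ}` is `χ_ℓ^{2k-3}`; (iii) `ρ_{f,ℓ}` is unramified outside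
`ℓN`; (iv) `det(1 - ρ_{f,ℓ}(Frob_p)T) = Q_p(f,T)` for all `p ∤ ℓN`; (v) the local Langlands
correspondence holds for all primes `p ≠ ℓ`, up to semisimplification.

**Proposition 4.3.2** (Schmidt). Let `f ∈ S_k(K(N))` be a cuspidal eigenform for all primes
`p ∤ N`. Let `p ∤ N` be prime and let `Q_p(f,T)` be the Hecke polynomial of `f` at `p` defined in
(4.2.18) in the arithmetic normalization. Then `f` is of type (G) if and only if all reciprocal
roots of `Q_p(f,T)` have complex absolute value `p^{k-3/2}`.

**§6.2** (p. ~1178): "There are no nontrivial weight 2 paramodular cusp forms of level 1, so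
since 277 is prime, `f₂₇₇` is a newform." — i.e. for PRIME level and weight `2` every cusp form is
new (paramodular oldforms come from lower levels [Roberts–Schmidt 2006], and `S₂(Sp₄(ℤ)) = 0`).

The text after Thm 4.3.4 (p. ~1170) records that Mok's theorem [Mok 2014, Thm 3.5], which supplies
`ρ_{f,ℓ}` for type (G) in general, **relies on work of Arthur in a crucial way** (the endoscopic
classification for `GSp₄`); the weight-2 case is NOT cohomological, so the representation is
constructed by congruences (Taylor 1991) — see the cell `pub-arthur`
(papers/Langlands/langlands-arthur-audit) for which inputs of Arthur's classification are closed in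
print. Users of this fact inherit that dependence; the docstring says so.

## What is transcribed here (special case, conclusions (iii)–(iv) only)
`BrumerEtAl2019.existsGaloisRep_weightTwo_primeLevel`: for `N` PRIME and weight `k = 2` — the case
of every level in [BrumerEtAl2019] and of the prime-level targets of the certificate programme —
with "newform of type (G)" unfolded by the two printed statements above into: `f ∈ S₂(K(N))`,
`f ≢ 0` on `ℍ₂`, `f` a `T(p)`-, `T₁(p²)`-eigenfunction for every prime `p ≠ N`, and the reciprocal
roots of `Q_{p₀}(f,T)` of absolute value `p₀^{1/2}` at ONE good prime `p₀`. Conclusion: for every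
prime `ℓ ≠ N` and every field isomorphism `ι : ℚ_ℓ^al ≃ ℂ` (used only to move the complex
coefficients of `Q_p(f,T)` to `ℚ_ℓ^al`; the tree's device, cf. `arithFrobPolyOfSatake`) there is a
continuous `ρ : Gal_ℚ → GL₄(ℚ_ℓ^al)` (the tree's `FramedGaloisRep ℚ (PadicAlgCl ℓ) 4`), unramified
at every prime `p ∤ ℓN`, whose arithmetic Frobenius at such `p` has characteristic polynomial
`X⁴ Q_p(f, 1/X) = X⁴ - a_p X³ + b_{p²} X² - p a_p X + p²` (`Polynomial.reverse` of `Q_p`, which is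
`det(X - ρ(Frob_p))` when `det(1 - ρ(Frob_p)T) = Q_p(f,T)`; the tree's `HasFrobCharpolyAt` is about
ARITHMETIC Frobenius, as is [BrumerEtAl2019, §2.1]).
-- TODO(general form): arbitrary level `N` and weight `k ≥ 2` need the global paramodular NEWFORM
-- notion (Roberts–Schmidt) which the tree lacks; conclusions (i), (ii) (values in `GSp₄` with
-- similitude `χ_ℓ^{2k-3}`), (v) and semisimplicity are not transcribed (the statement here is a
-- COROLLARY of the printed theorem, never stronger).
-/

namespace Literature.NumberTheory.Automorphic.Paramodular

open Literature.NumberTheory.GaloisRepresentations IsDedekindDomain NumberField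

namespace BrumerEtAl2019

/-- **Galois representations attached to weight-2 paramodular eigenforms of prime level**
[BrumerEtAl2019, Thm 4.3.4 (Taylor–Laumon–Weissauer–Schmidt–Mok) combined with Prop 4.3.2
(Schmidt's criterion for type (G)) and the newform remark of §6.2], SPECIAL CASE `N` prime, `k = 2`,
conclusions (iii) (unramified outside `ℓN`) and (iv) (`det(1 - ρ_{f,ℓ}(Frob_p)T) = Q_p(f,T)` for
`p ∤ ℓN`) only. Hypotheses (all printed): `f ∈ S₂(K(N))` a cusp form, not identically zero on `ℍ₂`,
an eigenfunction of `T(p)` and `T₁(p²)` for every prime `p ≠ N` (so, `N` being prime and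
`S₂(Sp₄(ℤ)) = 0`, a newform), and of type (G): at some prime `p₀ ≠ N` all reciprocal roots of
`Q_{p₀}(f,T)` have absolute value `p₀^{1/2}` (roots of absolute value `p₀^{-1/2}`). DEPENDS ON
ARTHUR'S CLASSIFICATION FOR `GSp₄` through Mok 2014 (see the module docstring; cell pub-arthur).
A user takes `(h : existsGaloisRep_weightTwo_primeLevel)` as an explicit hypothesis.
[cite: BrumerEtAl2019, Thm 4.3.4] -/
def existsGaloisRep_weightTwo_primeLevel : Prop :=
  ∀ (N : ℕ) [Fact N.Prime] (f : Matrix (Fin 2) (Fin 2) ℂ → ℂ),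
    IsParamodularCuspForm N 2 f →
    (∃ Z ∈ siegelUpperHalfSpace 2, f Z ≠ 0) →
    (∀ p : ℕ, p.Prime → p ≠ N → ∃ a a₁ : ℂ, IsHeckeEigenAt 2 p f a a₁) →
    (∃ p₀ : ℕ, p₀.Prime ∧ p₀ ≠ N ∧ ∃ Q : Polynomial ℂ, HasSpinorEulerFactorAt 2 p₀ f Q ∧
      ∀ z : ℂ, Q.IsRoot z → ‖z‖ = (Real.sqrt p₀)⁻¹) →
    ∀ (ℓ : ℕ) [Fact ℓ.Prime], ℓ ≠ N → ∀ ι : PadicAlgCl ℓ ≃+* ℂ,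
      ∃ ρ : FramedGaloisRep ℚ (PadicAlgCl ℓ) 4,
        ∀ (p : ℕ), p.Prime → p ≠ ℓ → p ≠ N →
          ∀ Q : Polynomial ℂ, HasSpinorEulerFactorAt 2 p f Q →
            ∀ v : HeightOneSpectrum (𝓞 ℚ), ((p : ℕ) : 𝓞 ℚ) ∈ v.asIdeal →
              ρ.IsUnramifiedAt v ∧
              ρ.HasFrobCharpolyAt v (Q.reverse.map (ι.symm : ℂ ≃+* PadicAlgCl ℓ).toRingHom)

end BrumerEtAl2019

/-- Sanity unfolding used by certificate assemblies: under the fact, a weight-2 prime-level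
eigenform as above has, for each `ℓ ≠ N` and `ι`, SOME framed `ℓ`-adic representation with the
prescribed Frobenius characteristic polynomials at all `p ∤ ℓN` (restatement with the hypotheses
as named arguments). [cite: BrumerEtAl2019, Thm 4.3.4] -/
theorem BrumerEtAl2019.existsGaloisRep_weightTwo_primeLevel.elim
    (h : BrumerEtAl2019.existsGaloisRep_weightTwo_primeLevel)
    {N : ℕ} [Fact N.Prime] {f : Matrix (Fin 2) (Fin 2) ℂ → ℂ} (hf : IsParamodularCuspForm N 2 f)
    (hne : ∃ Z ∈ siegelUpperHalfSpace 2, f Z ≠ 0)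
    (heig : ∀ p : ℕ, p.Prime → p ≠ N → ∃ a a₁ : ℂ, IsHeckeEigenAt 2 p f a a₁)
    (hG : ∃ p₀ : ℕ, p₀.Prime ∧ p₀ ≠ N ∧ ∃ Q : Polynomial ℂ, HasSpinorEulerFactorAt 2 p₀ f Q ∧
      ∀ z : ℂ, Q.IsRoot z → ‖z‖ = (Real.sqrt p₀)⁻¹)
    (ℓ : ℕ) [Fact ℓ.Prime] (hℓ : ℓ ≠ N) (ι : PadicAlgCl ℓ ≃+* ℂ) :
    ∃ ρ : FramedGaloisRep ℚ (PadicAlgCl ℓ) 4,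
      ∀ (p : ℕ), p.Prime → p ≠ ℓ → p ≠ N →
        ∀ Q : Polynomial ℂ, HasSpinorEulerFactorAt 2 p f Q →
          ∀ v : HeightOneSpectrum (𝓞 ℚ), ((p : ℕ) : 𝓞 ℚ) ∈ v.asIdeal →
            ρ.IsUnramifiedAt v ∧
            ρ.HasFrobCharpolyAt v (Q.reverse.map (ι.symm : ℂ ≃+* PadicAlgCl ℓ).toRingHom) :=
  h N f hf hne heig hG ℓ hℓ ι

end Literature.NumberTheory.Automorphic.Paramodular
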